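import Mathlib

/-!
# Galois CM fields and their CM types — the finite-group model

Blind re-derivation cell `pub-hodge-repro`, seat `typer` (gen 1, written from the sparse root).
Everything here is built on Mathlib only and follows the PRINTED definitions in

* B. B. Gordon, *A survey of the Hodge conjecture for abelian varieties* (Appendix B of J. D. Lewis,
  *A survey of the Hodge conjecture*, CRM Monograph 10; arXiv:alg-geom/9709030), cited as [Gordon].

[Gordon] §1.13.6 (p. 8): "an algebraic number field `K` is said to be a CM-field iff it is a totally
imaginary quadratic extension of a totally real number field `K₀`.  The embeddings of a CM-field `K` into
`ℂ` come in complex conjugate pairs.  Then CM-type for `K` is a subset `S ⊂ Hom(K, ℂ)` containing exactly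
one from each pair of conjugate embeddings, so that `Hom(K, ℂ) = S ∪ S̄`."

## The model

Let `K` be a CM field which is Galois over `ℚ`, `G = Gal(K/ℚ)`.  Fixing one embedding `ι : K ↪ ℂ`
identifies `Hom(K, ℂ)` with `G` via `g ↦ ι ∘ g`.  Complex conjugation on `ℂ` preserves `ι(K)` (Galois),
so it restricts to an element `c ∈ G`; `c` is an involution and is central (a CM field's complex conjugation
commutes with every embedding: `K₀ = K^c` is totally real and `K/K₀` is quadratic).  The conjugate of the
embedding `ι ∘ g` is `ι ∘ (c * g)`.

`Aut(ℂ/ℚ)` acts on `Hom(K, ℂ)` by post-composition; for a Galois `K` this is again LEFT multiplication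
by elements of `G` (`σ ∘ ι = ι ∘ a` for some `a ∈ G`).  This is the action used in Pohlmann's criterion as
printed in [Gordon] §9.2 (p. 24): "we let `σ ∈ Aut(ℂ/ℚ)` act on `f ∈ H^r(A, ℂ)`, with `f : ⋀^r K → ℂ`, by
`(σf)(λ) = σ(f(λ))`", so `σ⟨Δ⟩ = ⟨σΔ⟩` with `σΔ = {σ ∘ φ : φ ∈ Δ}`.

Hence the combinatorics of a CM type of a Galois CM field lives on a finite group `G` with a distinguished
central involution `c`:

* `HodgeRepro.IsComplexConj c` — `c` is a central involution of `G`;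
* `HodgeRepro.IsCMType c Φ` — `Φ : Finset G` contains exactly one of each pair `{g, c * g}`;
* `g • Φ` (pointwise `Finset` action, `open scoped Pointwise`) — the Galois conjugate type `gΦ`;
  `c • Φ = Φᶜ` is the complex conjugate type `Φ̄`;
* `HodgeRepro.IsHodgeSet c Φ Δ` — Pohlmann's condition (9.2.1) on a subset `Δ ⊆ G`;
* indicator vectors `HodgeRepro.ind S : G → ℚ` with `ind Δ ⬝ᵥ ind S = |Δ ∩ S|`.

Nothing in this file is specific to the degrees 6 / 8 / 12; concrete groups live in `Groups.lean`, the
rank of a CM type (= `dim MT`, [Gordon] §9.1) in `CMRank.lean`.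
-/

open Finset
open scoped Pointwise

namespace HodgeRepro

variable {G : Type*} [Group G]

/-! ### Complex conjugation -/

/-- `c : G` *is a complex conjugation*: a central element of order exactly `2`.  For the Galois group of a
Galois CM field this is the restriction of complex conjugation (see the module docstring). -/
structure IsComplexConj (c : G) : Prop where
  /-- complex conjugation is not the identity (a CM field is totally imaginary) -/
  ne_one : c ≠ 1
  /-- complex conjugation is an involution -/
  mul_self : c * c = 1
  /-- complex conjugation is central in the Galois group of a CM field -/
  comm : ∀ g : G, c * g = g * c

/-- `IsComplexConj` unfolded (the form used for decidability). -/
theorem isComplexConj_iff (c : G) :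
    IsComplexConj c ↔ c ≠ 1 ∧ c * c = 1 ∧ ∀ g : G, c * g = g * c :=
  ⟨fun h => ⟨h.ne_one, h.mul_self, h.comm⟩, fun h => ⟨h.1, h.2.1, h.2.2⟩⟩

/-- `IsComplexConj` is decidable on a finite group. -/
instance (c : G) [Fintype G] [DecidableEq G] : Decidable (IsComplexConj c) :=
  decidable_of_iff _ (isComplexConj_iff c).symm

/-- The complex conjugations of `G`: its central involutions. -/
def complexConjs (G : Type*) [Group G] [Fintype G] [DecidableEq G] : Finset G :=
  Finset.univ.filter fun c => IsComplexConj c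

/-- Membership in `complexConjs`. -/
theorem mem_complexConjs [Fintype G] [DecidableEq G] {c : G} :
    c ∈ complexConjs G ↔ IsComplexConj c := by
  simp [complexConjs]

namespace IsComplexConj

variable {c : G} (hc : IsComplexConj c)
include hc

/-- `c⁻¹ = c`. -/
theorem inv_eq : c⁻¹ = c := by
  rw [inv_eq_iff_mul_eq_one, hc.mul_self]

/-- Conjugating an embedding twice gives it back. -/
theorem mul_mul_cancel (g : G) : c * (c * g) = g := by
  rw [← mul_assoc, hc.mul_self, one_mul]

/-- Conjugation moves every embedding: `c * g ≠ g`. -/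
theorem mul_ne_self (g : G) : c * g ≠ g := by
  intro h
  exact hc.ne_one (mul_right_cancel (h.trans (one_mul g).symm))

/-- Applying conjugation twice to a subset of embeddings gives the subset back. -/
theorem smul_smul_finset [DecidableEq G] (Δ : Finset G) : c • c • Δ = Δ := by
  rw [smul_smul, hc.mul_self, one_smul]

/-- Conjugation commutes with every Galois translate of a subset. -/
theorem smul_comm_finset [DecidableEq G] (g : G) (Δ : Finset G) : c • g • Δ = g • c • Δ := by
  rw [smul_smul, smul_smul, hc.comm]

/-- Membership in the conjugate subset: `g ∈ c • Δ ↔ c * g ∈ Δ`. -/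
theorem mem_smul_iff [DecidableEq G] {Δ : Finset G} {g : G} : g ∈ c • Δ ↔ c * g ∈ Δ := by
  rw [← inv_smul_mem_iff, hc.inv_eq, smul_eq_mul]

/-- A subset is conjugation-stable iff it is closed under `g ↦ c * g`. -/
theorem smul_eq_self_iff [DecidableEq G] {Δ : Finset G} :
    c • Δ = Δ ↔ ∀ g, g ∈ Δ → c * g ∈ Δ := by
  constructor
  · intro h g hg
    rw [← hc.mem_smul_iff, h]; exact hg
  · intro h
    ext g
    rw [hc.mem_smul_iff]
    refine ⟨fun hg => ?_, h g⟩
    have := h _ hg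
    rwa [hc.mul_mul_cancel] at this

end IsComplexConj

/-! ### CM types -/

/-- A *CM type* for `(G, c)`: a subset `Φ ⊆ G` containing exactly one of each pair `{g, c * g}` of conjugate
embeddings ([Gordon] §1.13.6, quoted in the module docstring). -/
def IsCMType (c : G) (Φ : Finset G) : Prop :=
  ∀ g : G, g ∈ Φ ↔ c * g ∉ Φ

/-- `IsCMType` is decidable on a finite group. -/
instance (c : G) (Φ : Finset G) [Fintype G] [DecidableEq G] : Decidable (IsCMType c Φ) := by
  unfold IsCMType; infer_instance

namespace IsCMType

variable {c : G} {Φ : Finset G}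

/-- At least one of `g`, `c * g` lies in a CM type. -/
theorem mem_or_conj_mem (hΦ : IsCMType c Φ) (g : G) : g ∈ Φ ∨ c * g ∈ Φ := by
  by_cases h : g ∈ Φ
  · exact Or.inl h
  · exact Or.inr (by_contra fun h' => h ((hΦ g).2 h'))

/-- Not both `g` and `c * g` lie in a CM type. -/
theorem not_mem_and_conj_mem (hΦ : IsCMType c Φ) (g : G) : ¬ (g ∈ Φ ∧ c * g ∈ Φ) :=
  fun h => (hΦ g).1 h.1 h.2

/-- `c * g ∈ Φ ↔ g ∉ Φ` for a CM type. -/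
theorem conj_mem_iff (hΦ : IsCMType c Φ) (g : G) : c * g ∈ Φ ↔ g ∉ Φ := by
  rw [hΦ g, not_not]

/-- A CM type is never empty. -/
theorem ne_empty (hΦ : IsCMType c Φ) : Φ ≠ ∅ := by
  intro h
  rcases hΦ.mem_or_conj_mem 1 with h1 | h1 <;> simp [h] at h1

variable [DecidableEq G] [Fintype G]

/-- The complex conjugate type `c • Φ` is the complement of `Φ`. -/
theorem smul_eq_compl (hc : IsComplexConj c) (hΦ : IsCMType c Φ) : c • Φ = Φᶜ := by
  ext g
  rw [hc.mem_smul_iff, Finset.mem_compl]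
  constructor
  · intro h hg
    exact (hΦ g).1 hg h
  · intro hg
    rcases hΦ.mem_or_conj_mem g with h | h
    · exact absurd h hg
    · exact h

/-- A CM type and its conjugate are disjoint. -/
theorem disjoint_smul (hc : IsComplexConj c) (hΦ : IsCMType c Φ) : Disjoint Φ (c • Φ) := by
  rw [hΦ.smul_eq_compl hc]; exact disjoint_compl_right

/-- A CM type and its conjugate cover `G` (`Hom(K, ℂ) = S ∪ S̄`). -/
theorem union_smul_eq_univ (hc : IsComplexConj c) (hΦ : IsCMType c Φ) :
    Φ ∪ c • Φ = univ := by
  rw [hΦ.smul_eq_compl hc, union_compl]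

/-- `Φ` is a CM type iff its conjugate is its complement. -/
theorem iff_smul_eq_compl (hc : IsComplexConj c) : IsCMType c Φ ↔ c • Φ = Φᶜ := by
  refine ⟨fun hΦ => hΦ.smul_eq_compl hc, fun h g => ?_⟩
  have := Finset.ext_iff.1 h g
  rw [hc.mem_smul_iff, Finset.mem_compl] at this
  exact ⟨fun hg hcg => this.1 hcg hg, fun hcg => by_contra fun hg => hcg (this.2 hg)⟩

/-- Every Galois translate of a CM type is a CM type. -/
theorem smul (hc : IsComplexConj c) (hΦ : IsCMType c Φ) (g : G) : IsCMType c (g • Φ) := by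
  rw [iff_smul_eq_compl hc] at hΦ ⊢
  rw [hc.smul_comm_finset, hΦ]
  ext x
  rw [Finset.mem_compl, ← inv_smul_mem_iff, ← inv_smul_mem_iff, Finset.mem_compl]

/-- The conjugate of a CM type is a CM type. -/
theorem conj (hc : IsComplexConj c) (hΦ : IsCMType c Φ) : IsCMType c (c • Φ) :=
  hΦ.smul hc c

/-- The complement of a CM type is a CM type. -/
theorem compl (hc : IsComplexConj c) (hΦ : IsCMType c Φ) : IsCMType c Φᶜ := by
  rw [← hΦ.smul_eq_compl hc]; exact hΦ.conj hc

/-- A CM type has exactly half the elements of `G` (`[K : ℚ] = 2 dim A`). -/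
theorem two_mul_card (hc : IsComplexConj c) (hΦ : IsCMType c Φ) :
    2 * Φ.card = Fintype.card G := by
  have h1 := card_union_of_disjoint (hΦ.disjoint_smul hc)
  rw [hΦ.union_smul_eq_univ hc, card_univ, card_smul_finset] at h1
  omega

/-- A CM type `Φ` is determined by its trace on any set of representatives: `Φ` is a CM type iff it is
disjoint from `c • Φ` and has half the elements of `G`. -/
theorem iff_disjoint_and_card (hc : IsComplexConj c) :
    IsCMType c Φ ↔ Disjoint Φ (c • Φ) ∧ 2 * Φ.card = Fintype.card G := by
  refine ⟨fun hΦ => ⟨hΦ.disjoint_smul hc, hΦ.two_mul_card hc⟩, fun ⟨hd, hcard⟩ => ?_⟩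
  rw [iff_smul_eq_compl hc]
  have hsub : c • Φ ⊆ Φᶜ := subset_compl_iff_disjoint_left.2 hd
  refine eq_of_subset_of_card_le hsub ?_
  rw [card_compl, card_smul_finset]
  omega

end IsCMType

/-- All CM types of `(G, c)`, as a `Finset` of subsets (computable; `decide`-able for small `G`). -/
def cmTypes [Fintype G] [DecidableEq G] (c : G) : Finset (Finset G) :=
  Finset.univ.filter fun Φ => IsCMType c Φ

/-- Membership in `cmTypes`. -/
theorem mem_cmTypes [Fintype G] [DecidableEq G] {c : G} {Φ : Finset G} :
    Φ ∈ cmTypes c ↔ IsCMType c Φ := by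
  simp [cmTypes]

/-- The Galois translates and the conjugate of a CM type stay in `cmTypes`. -/
theorem smul_mem_cmTypes [Fintype G] [DecidableEq G] {c : G} (hc : IsComplexConj c) {Φ : Finset G}
    (hΦ : Φ ∈ cmTypes c) (g : G) : g • Φ ∈ cmTypes c := by
  rw [mem_cmTypes] at hΦ ⊢; exact hΦ.smul hc g

end HodgeRepro
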